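import Mathlib
import Summits.Ventures.Crystal3D.Theorems.StickyWulffConstantTextureLiminfRungPerBox
import Literature.Analysis.Convexity.AnisotropicPerimeterPolytopeUnion
import HarnessLib

/-!
# Line `TexShadow` (crux `TextureLiminf`, stmt-Ventures-19483): rung `rung_perTwoBoxes`

HONEST FRAMING. Part of the venture `Summits/Ventures/Crystal3D` (cell `crystal3d-full`), route
`route-Ventures-StickyWulffConstant`, crux `TextureLiminf` (stmt-Ventures-19483), line `TexShadow`;
second target of the planner's rungs file `TexShadowRungs.lean` (cf-p1 gen 16), in its spelling:
two open boxes glued along the face `x_0 = b_0` satisfy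
`Per_K(box ∪ box') = Per_K(box) + Per_K(box') − (h_K(e_0) + h_K(−e_0)) · (b_1 − a_1)(b_2 − a_2)` —
clause (B) (`Literature.Analysis.Convexity.toReal_anisotropicPerimeter_iUnion_openHPolytope`, eng g7)
for the two-cell family, the common face being the top facet of the first box.
WHAT THIS IS NOT: a registered stub; rung F-C1 not moved.
-/

noncomputable section

open scoped BigOperators InnerProductSpace ENNReal
open MeasureTheory

namespace Summit.Ventures.Crystal3D.Cruxes.TextureLiminf.TexShadow.Rungs

open Literature.Analysis.Convexity

/-- A nondegenerate open box is bounded. -/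
theorem isBounded_box (a b : E3) : Bornology.IsBounded (box a b) := by
  refine (Metric.isBounded_closedBall (x := (0 : E3)) (r := ‖a‖ + ‖b‖)).subset fun x hx => ?_
  rw [mem_closedBall_zero_iff]
  have hsq : ‖x‖ ^ 2 ≤ ‖a‖ ^ 2 + ‖b‖ ^ 2 := by
    rw [norm_sq_eq_sum_sq_coord, norm_sq_eq_sum_sq_coord, norm_sq_eq_sum_sq_coord, ← Finset.sum_add_distrib]
    refine Finset.sum_le_sum fun t _ => ?_
    obtain ⟨h1, h2⟩ := hx t
    rcases le_or_gt 0 (x t) with h | h <;> nlinarith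
  nlinarith [norm_nonneg x, norm_nonneg a, norm_nonneg b]

/-- **rung (two boxes glued along a common face)**.  Boxes `(a, b)` and `(a', b')` with `b 0 = a' 0` and the
same extent in the coordinates `1, 2`:
`Per_K(box ∪ box') = Per_K(box) + Per_K(box') − (h_K(e_0) + h_K(−e_0)) · (b_1 − a_1)(b_2 − a_2)` — clause (B) of
`PolytopeCalculus` for two cells whose closures meet in the common face `{x_0 = b_0}`. -/
theorem rung_perTwoBoxes :
    ∀ K : Set E3, IsCompact K → Convex ℝ K → (0 : E3) ∈ K → ∀ a b a' b' : E3, (∀ t, a t < b t) →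
      (∀ t, a' t < b' t) → b 0 = a' 0 → a 1 = a' 1 → b 1 = b' 1 → a 2 = a' 2 → b 2 = b' 2 →
      per K (box a b ∪ box a' b') =
        per K (box a b) + per K (box a' b') -
          (supportFn K (e 0) + supportFn K (-(e 0))) * ((b 1 - a 1) * (b 2 - a 2)) := by
  classical
  intro K hKc hK hK0 a b a' b' hab hab' h0 h1 h1' h2 h2'
  -- the two cells as a family over `Fin 2`
  set Q : Fin 2 → Set E3 := ![box a b, box a' b'] with hQdef
  set Hs : Fin 2 → Finset (E3 × ℝ) :=
    ![(Finset.univ : Finset (Fin 3)).image (fun t => (e t, b t)) ∪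
        (Finset.univ : Finset (Fin 3)).image (fun t => (-(e t), -(a t))),
      (Finset.univ : Finset (Fin 3)).image (fun t => (e t, b' t)) ∪
        (Finset.univ : Finset (Fin 3)).image (fun t => (-(e t), -(a' t)))] with hHsdef
  have hQ : ∀ i, Q i = ⋂ p ∈ Hs i, {x : E3 | ⟪p.1, x⟫_ℝ < p.2} := by
    intro i; fin_cases i
    · exact box_eq_iInter a b
    · exact box_eq_iInter a' b'
  have hbd : ∀ i, Bornology.IsBounded (Q i) := by
    intro i; fin_cases i
    · exact isBounded_box a b
    · exact isBounded_box a' b'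
  have hdisj01 : Disjoint (box a b) (box a' b') := by
    rw [Set.disjoint_left]
    intro x hx hx'
    have := (hx 0).2; have := (hx' 0).1; linarith
  have hdisj : ∀ i j, i ≠ j → Disjoint (Q i) (Q j) := by
    intro i j hij
    fin_cases i <;> fin_cases j
    · exact absurd rfl hij
    · exact hdisj01
    · exact hdisj01.symm
    · exact absurd rfl hij
  -- the common face
  have hface : closure (box a b) ∩ closure (box a' b') =
      {x : E3 | ∀ t, a t ≤ x t ∧ x t ≤ b t} ∩ {x : E3 | ⟪e 0, x⟫_ℝ = b 0} := by
    rw [closure_box a b hab, closure_box a' b' hab']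
    ext x
    simp only [Set.mem_inter_iff, Set.mem_setOf_eq, inner_e_left]
    constructor
    · rintro ⟨hx, hx'⟩
      exact ⟨hx, le_antisymm (hx 0).2 (h0 ▸ (hx' 0).1)⟩
    · rintro ⟨hx, hx0⟩
      refine ⟨hx, fun t => ?_⟩
      fin_cases t
      · show a' 0 ≤ x 0 ∧ x 0 ≤ b' 0
        exact ⟨by rw [← h0, hx0], by linarith [hab' 0, hx0, h0]⟩
      · show a' 1 ≤ x 1 ∧ x 1 ≤ b' 1
        exact ⟨by rw [← h1]; exact (hx 1).1, by rw [← h1']; exact (hx 1).2⟩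
      · show a' 2 ≤ x 2 ∧ x 2 ≤ b' 2
        exact ⟨by rw [← h2]; exact (hx 2).1, by rw [← h2']; exact (hx 2).2⟩
  have hν : ∀ i j : Fin 2, i ≠ j → ‖(fun _ _ : Fin 2 => e 0) i j‖ = 1 ∧ ∃ β : ℝ,
      closure (Q i) ∩ closure (Q j) ⊆ {x : E3 | ⟪(fun _ _ : Fin 2 => e 0) i j, x⟫_ℝ = β} := by
    intro i j hij
    refine ⟨by simp [e], b 0, ?_⟩
    fin_cases i <;> fin_cases j
    · exact absurd rfl hij
    · show closure (box a b) ∩ closure (box a' b') ⊆ _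
      rw [hface]; exact Set.inter_subset_right
    · show closure (box a' b') ∩ closure (box a b) ⊆ _
      rw [Set.inter_comm, hface]; exact Set.inter_subset_right
    · exact absurd rfl hij
  -- clause (B)
  have hB := toReal_anisotropicPerimeter_iUnion_openHPolytope Hs Q hQ (fun _ _ => e 0) hbd hdisj hν hKc hK hK0
  have hU : (⋃ i, Q i) = box a b ∪ box a' b' := by
    ext x
    simp only [Set.mem_iUnion, Set.mem_union, Fin.exists_fin_two]
    rfl
  simp only [per, perK_eq_anisotropicPerimeter, supportFn]
  rw [← hU, hB, Fin.sum_univ_two, Fin.sum_univ_two, Fin.sum_univ_two, Fin.sum_univ_two]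
  simp only [show ¬ ((0 : Fin 2) < 0) from lt_irrefl _, show (0 : Fin 2) < 1 from by decide,
    show ¬ ((1 : Fin 2) < 0) from by decide, show ¬ ((1 : Fin 2) < 1) from lt_irrefl _, if_true, if_false,
    add_zero, zero_add]
  have hQ0 : Q 0 = box a b := rfl
  have hQ1 : Q 1 = box a' b' := rfl
  rw [hQ0, hQ1, hface, (volume_prism_facets a b hab 0).1]
  have herase : (Finset.univ : Finset (Fin 3)).erase 0 = {1, 2} := by decide
  rw [herase, Finset.prod_pair (by decide : (1 : Fin 3) ≠ 2)]

end Summit.Ventures.Crystal3D.Cruxes.TextureLiminf.TexShadow.Rungs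

end
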